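import Literature.Dynamics.SymbolicDynamics.Hochman2025NewFrames
import HarnessLib

/-!
# Hochman 2025, §6.3 Steps C–D: witnesses of the new frames; the glued certificate is a dense
# valid certificate

Continuation of `Hochman2025NewFrames.lean` (§6.3 of M. Hochman, *Irreducibility and
periodicity in `ℤ²` symbolic systems*, Discrete Analysis 2025:17).

* **Witnesses of the new boxes** (Step C: "Apply Proposition 4.1 to each `Bᵢ` to find a path
  `γ` connecting its short edges and contained in the safe points of `R_C(Bᵢ)`. Since `Ê′`
  connects the long edges of `Bᵢ` we can choose `w ∈ γ ∩ Ê′`"): for each new box, a safe point of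
  the box for the obstacle family of the geometric certificate (Prop. 4.1 (2)), the safe path
  through it (Prop. 4.1 (3), `npath`), which stays inside the box (`path_in_box`), and its
  crossing with the gap continuum of the frame (`exists_mem_graph_of_isPreconnected`): the
  witness `nwit` is a gap point (free site), in its box, on the safe path.
* **The glued certificate** `Cfin D` = kept frames ∪ new frames; it is structurally well formed
  (`Cfin_wf`), its obstacle families are those of the geometric certificate (`familySet_Cfin`),
  and it is **valid** (`Cfin_valid`): new witnesses are safe by construction, kept witnesses stay
  safe because the boxes of new frames of lower level were chosen unthreatening
  (`gauge_gt_of_newFrame`, the "throw out the exceptional rectangle" of Step C) and safety is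
  local (`safe_mono_far`).
* **Density** (`Cfin_dense`, Step D and the "Interlude"): at large levels all `x`-frames are kept;
  at a small level, if a point `p` were `10 rₙ`-far from all centres, the unkept `x`- and
  `y`-centres within `10 rₙ` of `p` are close to the `y`-zone, resp. the `x`-zone, so a gap point
  `e` lies within `10.45 rₙ` of `p` (`exists_gap_near`, intermediate value theorem on a segment),
  the point `u'` at distance `0.95 rₙ` from `e` towards `p` is admissible and within `9.5 rₙ` of
  `p`, and the maximality of the new centres puts a new centre within `rₙ/2` of `u'` — a
  contradiction (Step D: "`u''` would already be `10 rₙ`-close to `v`").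

## References

* [Hochman2025] M. Hochman, op. cit., §6.3 Steps C–D and Interlude (pp. 33–35). Read via
  `lit read arxiv:2401.02273`.
-/

noncomputable section

open Set Metric Complex

namespace Literature.Dynamics.SymbolicDynamics

namespace Hochman2025

/-- Frame coordinates are continuous. [folklore] -/
theorem Plane.continuous_coords (v c : ℂ) : Continuous (Plane.coords v c) := by
  unfold Plane.coords
  fun_prop

namespace Gluing

open scoped NNReal

variable {P : Params}

/-! ### Safe paths through safe points, for any well-formed certificate -/

/-- **Prop. 4.1 (3) for the obstacle family of a box of a well-formed certificate**: every safe
point lies on a `K0`-Lipschitz path all of whose points are safe. [cite: Hochman2025, Prop 4.1 (3)] -/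
theorem exists_safePath_through (hP : P.Good) {C : Cert P} (hC : C.WF) {n : ℕ} (hn : 1 ≤ n)
    (G : Frame P n) (j : Fin (P.N n)) (𝔉 : Finset SafePoints.Diamond)
    (h𝔉 : (↑𝔉 : Set SafePoints.Diamond) = C.familySet G j) {p : ℝ × ℝ}
    (hp : p ∈ SafePoints.safe (P.famScales hP n) 𝔉) :
    ∃ f : ℝ → ℝ, LipschitzWith (SafePoints.K0 (P.famScales hP n)) f ∧ f p.1 = p.2 ∧
      ∀ x, (x, f x) ∈ SafePoints.safe (P.famScales hP n) 𝔉 := by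
  set ρ := SafePoints.RectScales.ofScales (P.famScales hP n) with hρ
  have hρσ : ρ.toScales = P.famScales hP n := SafePoints.RectScales.toScales_ofScales _
  have hgood : ρ.toScales.Good 10 := by rw [hρσ]; exact Params.famScales_good hP n
  have hsp : SafePoints.RectSparse ρ 𝔉 := Cert.familySet_rectSparse hP hC hn G j 𝔉 h𝔉
  obtain ⟨-, -, h3, -⟩ := SafePoints.prop_4_1 hgood hsp
  rw [hρσ] at h3
  exact h3 p hp

namespace Setup

variable (D : Setup P)

/-! ### The witnesses of the new boxes (Step C) -/

section NewWit

variable {D} {n : ℕ} (hn : 1 ≤ n) {u : ℂ} (hu : u ∈ D.NewCentres n)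

/-- The geometric frame at a new centre. [folklore] -/
abbrev gfr : Frame P n := newGeom hn u (D.buildable_of_newCentre hu)

/-- The obstacle family of a new box (for the geometric certificate). [cite: Hochman2025, §6.3 Step C] -/
def nfam (j : Fin (P.N n)) : Finset SafePoints.Diamond :=
  (Cert.familySet_finite D.hP D.Cgeom_wf (newGeom_mem_Cgeom hn hu) j).toFinset

/-- The obstacle family enumerates `R_{Cgeom}(B)`. [folklore] -/
theorem nfam_coe (j : Fin (P.N n)) :
    (↑(nfam hn hu j) : Set SafePoints.Diamond) = D.Cgeom.familySet (gfr hn hu) j :=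
  Set.Finite.coe_toFinset _

/-- **A safe path across a new box**: continuous, all points safe for the family of the box, and
at height strictly inside the box over its whole range. [cite: Hochman2025, §6.3 Step C ("find a
path `γ` connecting its short edges and contained in the safe points of `R_C(Bᵢ)`")] -/
theorem exists_npath (j : Fin (P.N n)) :
    ∃ f : ℝ → ℝ, Continuous f ∧ (∀ x, (x, f x) ∈ SafePoints.safe (P.famScales D.hP n) (nfam hn hu j)) ∧
      ∀ x ∈ Icc (-(99 / 100 * P.r n)) (-(P.r n / 10)),
        (gfr hn hu).t j + P.h n / 100 < f x ∧ f x < (gfr hn hu).t j + P.h n - P.h n / 100 := by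
  set G : Frame P n := gfr hn hu with hG
  have hP := D.hP
  have hr := P.r_pos n
  have hh := P.h_pos n
  obtain ⟨y, hy, hsafe⟩ := Cert.exists_safe_on_segment hP D.Cgeom_wf hn G j (nfam hn hu j) (nfam_coe hn hu j)
    (-(P.r n / 2)) (G.t j + P.h n / 50)
  obtain ⟨f, hlip, hthrough, hfsafe⟩ := exists_safePath_through hP D.Cgeom_wf hn G j (nfam hn hu j)
    (nfam_coe hn hu j) hsafe
  refine ⟨f, hlip.continuous, hfsafe, fun x hx => ?_⟩
  exact Cert.path_in_box hP hn G j (nfam_coe hn hu j) hlip.continuous hfsafe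
    (x₀ := -(P.r n / 2)) ⟨by linarith, by linarith⟩
    (by simp only at hthrough; rw [hthrough]; exact ⟨by linarith [hy.1], by linarith [hy.2]⟩) hx

/-- The chosen safe path across a new box. [cite: Hochman2025, §6.3 Step C] -/
def npath (j : Fin (P.N n)) : ℝ → ℝ := Classical.choose (exists_npath hn hu j)

/-- Properties of the chosen path. [cite: Hochman2025, §6.3 Step C] -/
theorem npath_spec (j : Fin (P.N n)) :
    Continuous (npath hn hu j) ∧
      (∀ x, (x, npath hn hu j x) ∈ SafePoints.safe (P.famScales D.hP n) (nfam hn hu j)) ∧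
      ∀ x ∈ Icc (-(99 / 100 * P.r n)) (-(P.r n / 10)),
        (gfr hn hu).t j + P.h n / 100 < npath hn hu j x ∧ npath hn hu j x < (gfr hn hu).t j + P.h n - P.h n / 100 :=
  Classical.choose_spec (exists_npath hn hu j)

/-- **The safe path crosses the gap continuum inside the box** ("Since `Ê′` connects the long
edges of `Bᵢ` we can choose `w ∈ γ ∩ Ê′`"). [cite: Hochman2025, §6.3 Step C] -/
theorem exists_nwit (j : Fin (P.N n)) :
    ∃ p ∈ PsetOf hn (D.buildable_of_newCentre hu),
      ((gfr hn hu).φ p).2 = npath hn hu j ((gfr hn hu).φ p).1 := by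
  set G : Frame P n := gfr hn hu with hG
  set hB := D.buildable_of_newCentre hu
  obtain ⟨-, hconn, hzone, -, -, ⟨plo, hplo, hplo2⟩, ⟨phi, hphi, hphi2⟩, -⟩ := frameData_spec hn hB
  obtain ⟨hfc, -, hfin⟩ := npath_spec hn hu j
  have hφ : ∀ p, G.φ p = Plane.coords (Plane.orient P.T (kOf hn hB)) u p := fun p => rfl
  obtain ⟨ht1, ht2⟩ := D.tsel_mem n u (kOf hn hB) (m1Of hn hB) j
  have htj : G.t j = D.tsel n u (kOf hn hB) (m1Of hn hB) j := rfl
  set K : Set (ℝ × ℝ) := G.φ '' PsetOf hn hB with hK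
  have hKc : IsPreconnected K := hconn.image _ (Plane.continuous_coords _ _).continuousOn
  have hh := P.h_pos n
  obtain ⟨uu, ⟨p, hp, rfl⟩, huu⟩ := exists_mem_graph_of_isPreconnected hfc hKc
    (p := G.φ plo) (q := G.φ phi) ⟨plo, hplo, rfl⟩ ⟨phi, hphi, rfl⟩
    (by
      have h1 := (hfin (G.φ plo).1 (by rw [hφ]; exact hzone plo hplo)).1
      rw [hφ] at h1 ⊢
      linarith)
    (by
      have h1 := (hfin (G.φ phi).1 (by rw [hφ]; exact hzone phi hphi)).2
      rw [hφ] at h1 ⊢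
      linarith)
  exact ⟨p, hp, huu⟩

/-- **The witness of a new box**: a point of the gap continuum on the safe path. [cite: Hochman2025, §6.3 Step C] -/
def nwit (j : Fin (P.N n)) : ℂ := Classical.choose (exists_nwit hn hu j)

/-- The witness lies on the gap continuum. [folklore] -/
theorem nwit_mem (j : Fin (P.N n)) : nwit hn hu j ∈ PsetOf hn (D.buildable_of_newCentre hu) :=
  (Classical.choose_spec (exists_nwit hn hu j)).1

/-- The witness lies on the safe path. [folklore] -/
theorem nwit_graph (j : Fin (P.N n)) :
    ((gfr hn hu).φ (nwit hn hu j)).2 = npath hn hu j ((gfr hn hu).φ (nwit hn hu j)).1 :=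
  (Classical.choose_spec (exists_nwit hn hu j)).2

/-- **The witness of a new box is a gap point** (so its site is free). [cite: Hochman2025, §6.3 Step C
("all witnesses `w` in `F` lie in `Ê`")] -/
theorem nwit_mem_gap (j : Fin (P.N n)) : nwit hn hu j ∈ Gap D.J :=
  (frameData_spec hn (D.buildable_of_newCentre hu)).1 (nwit_mem hn hu j)

/-- The abscissa of the witness lies in the box range. [folklore] -/
theorem nwit_fst_mem (j : Fin (P.N n)) :
    ((gfr hn hu).φ (nwit hn hu j)).1 ∈ Icc (-(99 / 100 * P.r n)) (-(P.r n / 10)) :=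
  (frameData_spec hn (D.buildable_of_newCentre hu)).2.2.1 _ (nwit_mem hn hu j)

/-- **The witness of a new box is safe** for the obstacle family of the box. [cite: Hochman2025, §6.3 Step C] -/
theorem nwit_safe (j : Fin (P.N n)) :
    (gfr hn hu).φ (nwit hn hu j) ∈ SafePoints.safe (P.famScales D.hP n) (nfam hn hu j) := by
  have h := (npath_spec hn hu j).2.1 ((gfr hn hu).φ (nwit hn hu j)).1
  rw [← nwit_graph hn hu j] at h
  exact h

variable (u) in
/-- **The new frame** at a new centre: the geometric frame with the crossing witnesses and their
sections. [cite: Hochman2025, §6.3 Steps C–D] -/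
def newFrame : Frame P n where
  c := u
  k := kOf hn (D.buildable_of_newCentre hu)
  t := (gfr hn hu).t
  w j := nwit hn hu j
  σ j := sectIdx D.hP n ((gfr hn hu).φ (nwit hn hu j)).1

/-- The new frame has the geometry of the geometric frame. [folklore] -/
theorem newFrame_sameGeom : Cert.SameGeom (gfr hn hu) (newFrame hn u hu) := ⟨rfl, rfl, rfl⟩

/-- The new frame is well formed. [cite: Hochman2025, §6.3 Step C] -/
theorem newFrame_wf : (newFrame hn u hu).WF where
  band := (newGeom_wf hn u (D.buildable_of_newCentre hu)).band
  apart := (newGeom_wf hn u (D.buildable_of_newCentre hu)).apart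
  wit j := by
    have hsg := newFrame_sameGeom hn hu
    rw [← hsg.sect_eq]
    change nwit hn hu j ∈ (gfr hn hu).sect j (sectIdx D.hP n ((gfr hn hu).φ (nwit hn hu j)).1)
    apply mem_sect_of_φ D.hP (gfr hn hu) j (nwit_fst_mem hn hu j)
    rw [nwit_graph]
    have := (npath_spec hn hu j).2.2 _ (nwit_fst_mem hn hu j)
    have hh := P.h_pos n
    exact ⟨by linarith [this.1], by linarith [this.2]⟩

end NewWit

/-! ### The glued certificate -/

/-- **The glued certificate `C`** of §6.3: kept (relocated) frames of both certificates and the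
new frames at the new centres. [cite: Hochman2025, §6.3 ("This concludes the construction")] -/
def Cfin : Cert P where
  frames n := D.Ck.frames n ∪ {F | ∃ (hn : 1 ≤ n) (u : ℂ) (hu : u ∈ D.NewCentres n), F = newFrame hn u hu}

variable {D}

/-- Membership in the glued certificate. [folklore] -/
theorem mem_Cfin {n : ℕ} {F : Frame P n} :
    F ∈ D.Cfin.frames n ↔ F ∈ D.Ck.frames n ∨ ∃ (hn : 1 ≤ n) (u : ℂ) (hu : u ∈ D.NewCentres n), F = newFrame hn u hu :=
  Iff.rfl

/-- Kept frames are frames of the glued certificate. [folklore] -/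
theorem mem_Cfin_of_mem_Ck {n : ℕ} {F : Frame P n} (hF : F ∈ D.Ck.frames n) : F ∈ D.Cfin.frames n := Or.inl hF

/-- New frames are frames of the glued certificate. [folklore] -/
theorem newFrame_mem_Cfin {n : ℕ} (hn : 1 ≤ n) {u : ℂ} (hu : u ∈ D.NewCentres n) :
    newFrame hn u hu ∈ D.Cfin.frames n := Or.inr ⟨hn, u, hu, rfl⟩

/-- **The glued certificate is structurally well formed.** [cite: Hochman2025, §6.3 Steps C–D] -/
theorem Cfin_wf : D.Cfin.WF := by
  have hkw := (D.Ck_valid).wf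
  refine ⟨fun n F hF => ?_, fun n F hF F' hF' hne => ?_⟩
  · rcases mem_Cfin.mp hF with hF | ⟨hn, u, hu, rfl⟩
    · exact hkw.frame n F hF
    · exact newFrame_wf hn hu
  · rcases mem_Cfin.mp hF with hF | ⟨hn, u, hu, rfl⟩ <;> rcases mem_Cfin.mp hF' with hF' | ⟨hn', u', hu', rfl⟩
    · exact hkw.sep n F hF F' hF' hne
    · have := (D.newCentres_subset n hu').2 F.c ⟨F, hF, rfl⟩
      change P.r n / 2 ≤ ‖F.c - u'‖
      rw [← norm_neg, neg_sub]; exact this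
    · exact (D.newCentres_subset n hu).2 F'.c ⟨F', hF', rfl⟩
    · have huu' : u ≠ u' := by rintro rfl; exact hne rfl
      exact D.newCentres_sep n hu hu' huu'

/-- **The obstacle families of the glued certificate are those of the geometric certificate**
(same frames up to witnesses). [folklore] -/
theorem familySet_Cfin {n : ℕ} {F₀ F₁ : Frame P n} (hF : Cert.SameGeom F₀ F₁) (j : Fin (P.N n)) :
    D.Cfin.familySet F₁ j = D.Cgeom.familySet F₀ j := by
  apply Cert.familySet_congr
  · intro k G₀ hG₀
    rcases mem_Cgeom.mp hG₀ with h | ⟨hk, u, hu, rfl⟩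
    · exact ⟨G₀, mem_Cfin_of_mem_Ck h, rfl, rfl, rfl⟩
    · exact ⟨newFrame hk u hu, newFrame_mem_Cfin hk hu, newFrame_sameGeom hk hu⟩
  · intro k G₁ hG₁
    rcases mem_Cfin.mp hG₁ with h | ⟨hk, u, hu, rfl⟩
    · exact ⟨G₁, mem_Cgeom_of_mem_Ck h, rfl, rfl, rfl⟩
    · exact ⟨newGeom hk u (D.buildable_of_newCentre hu), newGeom_mem_Cgeom hk hu, newFrame_sameGeom hk hu⟩
  · exact hF

/-! ### Validity of the glued certificate -/

/-- **New boxes do not threaten kept witnesses**: the double-section member of a box of a new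
frame of lower level `k < n` and the same orientation is at gauge distance `> 19` from every
witness of a kept frame of level `n` (otherwise that witness would threaten the box, which was
chosen unthreatened). [cite: Hochman2025, §6.3 Step C ("for all but at most one of them, all
sections `S` of `Rᵢ` satisfy `w ∉ 20S`. If there is an exceptional one, throw it out")] -/
theorem gauge_gt_of_newFrame {n : ℕ} {F : Frame P n} (hF : F ∈ D.Ck.frames n) (j : Fin (P.N n))
    {k : ℕ} (hk : 1 ≤ k) (hkn : k < n) {u : ℂ} (hu : u ∈ D.NewCentres k)
    (hkk : (newFrame hk u hu).k = F.k) (j' : Fin (P.N k)) (i₀ : Fin P.S) :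
    19 < SafePoints.gauge (P.famScales D.hP n) (k - 1)
      (F.φ (F.w j) - (Cert.ddDiamond F (newFrame hk u hu) j' i₀).c) := by
  have hP := D.hP
  set F' := newFrame hk u hu with hF'
  set hB := D.buildable_of_newCentre hu
  by_contra hle
  push Not at hle
  obtain ⟨h1, h2⟩ := abs_le_of_gauge_le hP hk hkn hle
  simp only [Cert.ddDiamond, Prod.fst_sub, Prod.snd_sub] at h1 h2
  -- the box `j'` is the unthreatened candidate `i`
  set i := D.goodIdx k u (kOf hk hB) (m1Of hk hB) j' with hi
  have hgood := (D.mem_goodSet.mp (D.goodIdx_mem k u (kOf hk hB) (m1Of hk hB) j')).2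
  apply hgood
  -- `F.w j` threatens it
  have hφ := φ_eq_φ_add F F' hkk (F.w j)
  have hFc : F'.c = u := rfl
  have ht : F'.t j' = candT P k (m1Of hk hB) i := rfl
  rw [hFc] at hφ h1 h2
  have hφ1 : (F.φ (F.w j)).1 = (F'.φ (F.w j)).1 + (F.φ u).1 := by rw [hφ]; rfl
  have hφ2 : (F.φ (F.w j)).2 = (F'.φ (F.w j)).2 + (F.φ u).2 := by rw [hφ]; rfl
  rw [ht] at h2
  have hcoords : F'.φ (F.w j) = Plane.coords (Plane.orient P.T (kOf hk hB)) u (F.w j) := rfl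
  refine ⟨n, hkn, F, hF, hkk.symm, j, ?_, ?_⟩
  · -- distance to `u`
    have hn2 := Plane.norm_sub_le_coords F'.v F'.c (F.w j) u F'.norm_v
    change ‖F.w j - u‖ ≤ |(F'.φ (F.w j)).1 - (Plane.coords F'.v u u).1| +
      |(F'.φ (F.w j)).2 - (Plane.coords F'.v u u).2| at hn2
    rw [Plane.coords_self] at hn2
    simp only [sub_zero] at hn2
    have hrk := P.r_pos k
    have hℓ := ℓ_le_r hP k
    have hℓp := Params.ℓ_pos hP k
    have hhk : 10000 * P.h k ≤ P.r k := Params.h_le_r hP hk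
    have hSℓ := S_mul_ℓ hP k
    have hi₀S : ((i₀ : ℕ) : ℝ) ≤ P.S - 1 := by
      have : (i₀ : ℕ) + 1 ≤ P.S := i₀.2
      have : (((i₀ : ℕ) + 1 : ℕ) : ℝ) ≤ P.S := by exact_mod_cast this
      push_cast at this; linarith
    obtain ⟨htm1, htm2⟩ := D.tsel_mem k u (kOf hk hB) (m1Of hk hB) j'
    obtain ⟨-, -, -, hm1, hm2, -, -, -⟩ := frameData_spec hk hB
    have htsel : D.tsel k u (kOf hk hB) (m1Of hk hB) j' = candT P k (m1Of hk hB) i := rfl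
    rw [htsel] at htm1 htm2
    have hx : |(F'.φ (F.w j)).1| ≤ 106 / 100 * P.r k := by
      rw [abs_le] at h1 ⊢
      have e : (((i₀ : ℕ) : ℝ) + 1) * P.ℓ k ≤ (P.S : ℝ) * P.ℓ k :=
        mul_le_mul_of_nonneg_right (by linarith) hℓp.le
      have e0 : 0 ≤ (((i₀ : ℕ) : ℝ) + 1) * P.ℓ k := by positivity
      constructor <;> linarith
    have hy : |(F'.φ (F.w j)).2| ≤ 44 / 1000 * P.r k := by
      rw [abs_le] at h2 ⊢
      have hw := w₀_nonneg (P := P) k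
      constructor <;> linarith [P.h_pos k]
    linarith
  · have e2 : (F.φ (F.w j)).2 - ((F.φ u).2 + candT P k (m1Of hk hB) i + P.h k / 2) =
        (F'.φ (F.w j)).2 - (candT P k (m1Of hk hB) i + P.h k / 2) := by rw [hφ2]; ring
    rw [e2, hcoords] at h2
    have := P.h_pos k
    exact le_trans h2 (by linarith)

/-- **The glued certificate has safe witnesses.** [cite: Hochman2025, §6.3 Steps A–D] -/
theorem Cfin_witSafe : D.Cfin.WitSafe D.hP := by
  have hP := D.hP
  intro n hn F hF j 𝔉 h𝔉
  have hgood := Params.famScales_good hP n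
  rcases mem_Cfin.mp hF with hF | ⟨hn', u, hu, rfl⟩
  · -- a kept frame: safe for the kept family, new-frame members are far
    set 𝔉₀ := (Cert.familySet_finite hP D.Ck_valid.wf hF j).toFinset with h𝔉₀
    have hcoe : (↑𝔉₀ : Set SafePoints.Diamond) = D.Ck.familySet F j := Set.Finite.coe_toFinset _
    have hsafe₀ := D.Ck_valid.safe n hn F hF j 𝔉₀ hcoe
    refine SafePoints.safe_mono_far hgood hsafe₀ fun A hA hA₀ => ?_
    have hA' : A ∈ D.Cfin.familySet F j := by rw [← h𝔉]; exact hA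
    have hA₀' : A ∉ D.Ck.familySet F j := by rw [← hcoe]; exact hA₀
    rcases hA' with hstrip | ⟨k, hk, F', hF', hkk, j', h, rfl⟩
    · exact absurd (Or.inl hstrip) hA₀'
    · rcases mem_Cfin.mp hF' with hF' | ⟨hk1, u, hu, rfl⟩
      · exact absurd (Or.inr ⟨k, hk, F', hF', hkk, j', h, rfl⟩) hA₀'
      · exact gauge_gt_of_newFrame hF j hk.1 hk.2 hu hkk j' _
  · -- a new frame: safe by construction
    have hfam : D.Cfin.familySet (newFrame hn' u hu) j = D.Cgeom.familySet (gfr hn' hu) j :=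
      familySet_Cfin (newFrame_sameGeom hn' hu) j
    have h𝔉' : 𝔉 = nfam hn' hu j := Finset.coe_injective (by rw [h𝔉, hfam, nfam_coe])
    rw [h𝔉', ← (newFrame_sameGeom hn' hu).φ_eq]
    exact nwit_safe hn' hu j

/-- **The glued certificate is a valid certificate.** [cite: Hochman2025, §6.3 ("We have shown that
`C ∪ {F′}` is a certificate")] -/
theorem Cfin_valid : D.Cfin.Valid D.hP := ⟨Cfin_wf, Cfin_witSafe⟩

/-! ### Density of the glued certificate (Step D) -/

/-- `‖z‖ ≤ 1.42 supNorm z`. [folklore] -/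
theorem norm_le_supNorm (z : ℂ) : ‖z‖ ≤ 142 / 100 * supNorm z := by
  have h1 := abs_re_le_supNorm z
  have h2 := abs_im_le_supNorm z
  have hs := supNorm_nonneg z
  have hsq : ‖z‖ ^ 2 ≤ (142 / 100 * supNorm z) ^ 2 := by
    rw [Complex.sq_norm, Complex.normSq_apply]
    nlinarith [sq_abs z.re, sq_abs z.im, abs_nonneg z.re, abs_nonneg z.im]
  exact (pow_le_pow_iff_left₀ (norm_nonneg _) (by positivity) two_ne_zero).mp hsq

/-- Near a point not deep in the `x`-zone there is a point of the `y`-zone. [folklore] -/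
theorem exists_V_near (hJ : D.J.Nonempty) {c : ℂ} {t : ℝ} (h : α D.J c < t) :
    ∃ q ∈ V D.J, ‖c - q‖ ≤ 142 / 100 * (t + 20) := by
  obtain ⟨v, hv, hlt⟩ := exists_lt_of_sdist_lt (compl_outer_nonempty hJ) h
  have hv' : v ∉ Outer 20 D.J := hv
  -- a site of `J`, or an island site, within sup-distance `20` of `v`, deep in the `y`-zone
  have key : ∃ q ∈ V D.J, supNorm (pt v - q) ≤ 20 := by
    by_cases hvJ : v ∈ D.J
    · exact ⟨pt v, le_β_of_near_mem hJ hvJ (by simp) |> fun h => show 21 / 2 < β D.J (pt v) by linarith,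
        by simp⟩
    · by_cases hfar : v ∈ Far 20 D.J
      · -- island site: far from all outer sites
        refine ⟨pt v, ?_, by simp⟩
        show 21 / 2 < β D.J (pt v)
        have : 21 ≤ β D.J (pt v) := by
          apply le_sdist (outer_nonempty hJ)
          intro o ho
          rw [supNorm_pt_sub_pt]
          by_contra hlt'
          push Not at hlt'
          have hle : ldist v o ≤ 20 := by
            have : (ldist v o : ℝ) < 21 := hlt'
            exact_mod_cast Nat.lt_succ_iff.mp (by exact_mod_cast this)
          exact hv' (mem_outer_of_reflTransGen
            (Relation.ReflTransGen.single ⟨hfar, outer_subset_far ho, (dist_le_iff 20 _ _).mpr hle⟩) ho)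
        linarith
      · rw [mem_far_iff] at hfar
        push Not at hfar
        obtain ⟨f, hf, hle⟩ := hfar
        refine ⟨pt f, ?_, ?_⟩
        · show 21 / 2 < β D.J (pt f)
          have := le_β_of_near_mem hJ hf (p := pt f) (by simp)
          linarith
        · rw [supNorm_pt_sub_pt]; exact_mod_cast hle
  obtain ⟨q, hqV, hq⟩ := key
  refine ⟨q, hqV, ?_⟩
  have h1 := supNorm_sub_le c (pt v) q
  have h2 := norm_le_supNorm (c - q)
  nlinarith [supNorm_nonneg (c - q)]

/-- Near a point not deep in the `y`-zone there is a point of the `x`-zone. [folklore] -/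
theorem exists_U_near (hJ : D.J.Nonempty) {c : ℂ} {t : ℝ} (h : β D.J c < t) :
    ∃ q ∈ U D.J, ‖c - q‖ ≤ 142 / 100 * t := by
  obtain ⟨o, ho, hlt⟩ := exists_lt_of_sdist_lt (outer_nonempty hJ) h
  refine ⟨pt o, ?_, ?_⟩
  · show β D.J (pt o) < 21 / 2
    have := sdist_le (A := Outer 20 D.J) (p := pt o) ho
    simp at this
    change β D.J (pt o) ≤ 0 at this
    linarith
  · have h2 := norm_le_supNorm (c - pt o)
    nlinarith [supNorm_nonneg (c - pt o)]

/-- **A gap point near every poorly covered point** (intermediate value theorem on the segment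
from an `x`-zone point to a `y`-zone point). [cite: Hochman2025, §6.3 Step D ("Let `e ∈ Ê` be a
point with `d(e, u) ≤ ¼ rₙ`")] -/
theorem exists_gap_near (hJ : D.J.Nonempty) {p cx cy : ℂ} {R t : ℝ} (hx : ‖p - cx‖ ≤ R) (hy : ‖p - cy‖ ≤ R)
    (hαx : α D.J cx < t) (hβy : β D.J cy < t) :
    ∃ e ∈ Gap D.J, ‖e - p‖ ≤ R + 142 / 100 * (t + 20) := by
  obtain ⟨qV, hqV, hqVd⟩ := exists_V_near (D := D) hJ hαx
  obtain ⟨qU, hqU, hqUd⟩ := exists_U_near (D := D) hJ hβy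
  set M := R + 142 / 100 * (t + 20) with hM
  have hVp : ‖qV - p‖ ≤ M := by
    have := norm_sub_le (qV - cx) (p - cx)
    rw [show qV - cx - (p - cx) = qV - p by ring] at this
    rw [← norm_neg (qV - cx), neg_sub] at this
    have ht0 : 0 ≤ 142 / 100 * (20 : ℝ) := by norm_num
    linarith
  have hUp : ‖qU - p‖ ≤ M := by
    have := norm_sub_le (qU - cy) (p - cy)
    rw [show qU - cy - (p - cy) = qU - p by ring] at this
    rw [← norm_neg (qU - cy), neg_sub] at this
    have : 0 ≤ 142 / 100 * (20 : ℝ) := by norm_num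
    have ht : 0 ≤ t := le_trans (β_nonneg hJ cy) hβy.le
    nlinarith
  -- IVT on the segment `s ↦ qU + s (qV - qU)`
  set g : ℝ → ℝ := fun s => β D.J (qU + (s : ℂ) * (qV - qU)) with hg
  have hgc : Continuous g := (continuous_β hJ).comp (by fun_prop)
  have hg0 : g 0 < 21 / 2 := by
    have h : β D.J qU < 21 / 2 := hqU
    simp only [hg]; simpa using h
  have hg1 : 21 / 2 < g 1 := by
    have h : 21 / 2 < β D.J qV := hqV
    simp only [hg]; simpa using h
  obtain ⟨s, hs, hgs⟩ := intermediate_value_Icc (zero_le_one' ℝ) hgc.continuousOn ⟨hg0.le, hg1.le⟩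
  refine ⟨qU + (s : ℂ) * (qV - qU), hgs, ?_⟩
  have e : qU + (s : ℂ) * (qV - qU) - p = ((1 - s : ℝ) : ℂ) * (qU - p) + (s : ℂ) * (qV - p) := by
    push_cast; ring
  rw [e]
  calc ‖((1 - s : ℝ) : ℂ) * (qU - p) + (s : ℂ) * (qV - p)‖
      ≤ ‖((1 - s : ℝ) : ℂ) * (qU - p)‖ + ‖(s : ℂ) * (qV - p)‖ := norm_add_le _ _
    _ = (1 - s) * ‖qU - p‖ + s * ‖qV - p‖ := by
        rw [norm_mul, norm_mul, Complex.norm_real, Complex.norm_real, Real.norm_eq_abs,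
          Real.norm_eq_abs, abs_of_nonneg (by linarith [hs.2]), abs_of_nonneg hs.1]
    _ ≤ (1 - s) * M + s * M := by
        have := hs.1; have := hs.2
        nlinarith
    _ = M := by ring

/-- **The glued certificate is dense.** [cite: Hochman2025, §6.3 Step D and Interlude] -/
theorem Cfin_dense : D.Cfin.Dense := by
  have hP := D.hP
  have hJ := D.hJ
  intro n hn p
  by_cases hL : Large P D.J n
  · -- large level: all `x`-frames are kept
    obtain ⟨Gx, hGx, hd⟩ := D.hDx n hn p
    exact ⟨relocFrame hP D.J D.hVx hn Gx hGx,
      mem_Cfin_of_mem_Ck (relocFrame_mem_Ckept_x (hVy := D.hVy) hn hGx (Or.inl hL)), hd⟩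
  · by_contra hcon
    push Not at hcon
    have hr := P.r_pos n
    have hr8 := r_ge hP hn
    obtain ⟨Gx, hGx, hdx⟩ := D.hDx n hn p
    obtain ⟨Gy, hGy, hdy⟩ := D.hDy n hn p
    -- the two centres are not kept, hence not deep
    have hαx : α D.J Gx.c < 3 / 10 * P.r n + 40 := by
      by_contra hge
      push Not at hge
      have := hcon _ (mem_Cfin_of_mem_Ck (relocFrame_mem_Ckept_x (hVy := D.hVy) hn hGx (Or.inr hge)))
      change 10 * P.r n < ‖p - Gx.c‖ at this
      linarith
    have hβy : β D.J Gy.c < 3 / 10 * P.r n + 40 := by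
      by_contra hge
      push Not at hge
      have := hcon _ (mem_Cfin_of_mem_Ck (relocFrame_mem_Ckept_y (hVx := D.hVx) hn hGy ⟨hL, hge⟩))
      change 10 * P.r n < ‖p - Gy.c‖ at this
      linarith
    -- a gap point `e` within `10.45 r` of `p`
    obtain ⟨e, he, hed⟩ := exists_gap_near (D := D) hJ hdx hdy hαx hβy
    have hed' : ‖e - p‖ ≤ 1045 / 100 * P.r n := by nlinarith
    -- the admissible point `u'` at distance `0.95 r` from `e` towards `p`
    obtain ⟨u', hu'e, hu'p⟩ : ∃ u' : ℂ, ‖e - u'‖ = 95 / 100 * P.r n ∧ ‖u' - p‖ ≤ 95 / 10 * P.r n := by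
      by_cases hfar : 95 / 100 * P.r n ≤ ‖p - e‖
      · have hpe' : ‖p - e‖ = ‖e - p‖ := by rw [← norm_neg, neg_sub]
        rw [hpe'] at hfar
        have hpe : 0 < ‖e - p‖ := lt_of_lt_of_le (by positivity) hfar
        set c : ℝ := 95 / 100 * P.r n / ‖e - p‖ with hc
        refine ⟨e + (c : ℂ) * (p - e), ?_, ?_⟩
        · rw [show e - (e + (c : ℂ) * (p - e)) = (c : ℂ) * (e - p) by ring, norm_mul,
            Complex.norm_real, Real.norm_eq_abs, abs_of_pos (by positivity), hc, div_mul_cancel₀ _ hpe.ne']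
        · have e1 : e + (c : ℂ) * (p - e) - p = ((1 - c : ℝ) : ℂ) * (e - p) := by push_cast; ring
          have hc1 : c ≤ 1 := by rw [hc, div_le_one hpe]; exact hfar
          rw [e1, norm_mul, Complex.norm_real, Real.norm_eq_abs, abs_of_nonneg (by linarith), sub_mul,
            one_mul, hc, div_mul_cancel₀ _ hpe.ne']
          linarith
      · push Not at hfar
        refine ⟨e + ((95 / 100 * P.r n : ℝ) : ℂ), ?_, ?_⟩
        · rw [show e - (e + ((95 / 100 * P.r n : ℝ) : ℂ)) = -(((95 / 100 * P.r n : ℝ) : ℂ)) by ring,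
            norm_neg, Complex.norm_real, Real.norm_eq_abs, abs_of_pos (by positivity)]
        · have := norm_add_le (e - p) (((95 / 100 * P.r n : ℝ) : ℂ))
          rw [show e - p + ((95 / 100 * P.r n : ℝ) : ℂ) = e + ((95 / 100 * P.r n : ℝ) : ℂ) - p by ring] at this
          rw [Complex.norm_real, Real.norm_eq_abs, abs_of_pos (by positivity)] at this
          rw [← norm_neg (p - e), neg_sub] at hfar
          linarith
    -- `u'` is admissible
    have hB : D.Buildable n u' := ⟨hL, e, he, by rw [hu'e]; linarith, by rw [hu'e]; linarith⟩
    have hadm : u' ∈ D.Admissible n := by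
      refine ⟨hB, fun c ⟨F, hF, hFc⟩ => ?_⟩
      by_contra hlt
      push Not at hlt
      have := hcon F (mem_Cfin_of_mem_Ck hF)
      rw [hFc] at this
      have h3 : ‖p - c‖ ≤ ‖u' - p‖ + ‖u' - c‖ := by
        have := norm_sub_le (u' - c) (u' - p)
        rw [show u' - c - (u' - p) = p - c by ring] at this
        linarith
      linarith
    -- maximality: a new centre within `r/2` of `u'`
    obtain ⟨v, hv, hvd⟩ := D.exists_newCentre_near hadm
    have := hcon (newFrame hn v hv) (newFrame_mem_Cfin hn hv)
    change 10 * P.r n < ‖p - v‖ at this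
    have h3 : ‖p - v‖ ≤ ‖u' - p‖ + ‖u' - v‖ := by
      have := norm_sub_le (u' - v) (u' - p)
      rw [show u' - v - (u' - p) = p - v by ring] at this
      linarith
    linarith

end Setup

end Gluing

end Hochman2025

end Literature.Dynamics.SymbolicDynamics
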